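/-
Copyright (c) 2026. Released under Apache 2.0 license.
-/
import Literature.Computability.StringMatching.PrefixTable
import Mathlib.Data.List.Palindrome
import Mathlib.Algebra.Group.Nat.Even
import HarnessLib

/-!
# Symmetries in texts: radii of palindromes and even palstars

A specification-level formalisation of the first half of §8.3 *Searching for symmetric words* of
Crochemore–Rytter, *Text Algorithms* (1994), over `List α`.

* **Table `Rad` (Manacher).**  `erad x c` is the radius of the longest even palindrome of `x`
  centred between positions `c - 1` and `c` (the book's `Rad[i]`, stated through the longest
  common prefix `lcp` of `Literature.Computability.StringMatching.PrefixTable`): the invariant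
  `w(i, j)` letterwise (`getElem?_eq_of_lt_erad`), maximality (`getElem?_ne_at_erad`), the
  characterisations `le_erad_of` / `erad_eq_of`, and **Lemma 8.11** — for `1 ≤ k ≤ Rad[i]` with
  `Rad[i-k] ≠ Rad[i]-k` one has `Rad[i+k] = min(Rad[i-k], Rad[i]-k)` (`erad_add_eq_min`; the
  underlying inequality `min(Rad[i-k], Rad[i]-k) ≤ Rad[i+k]` is `min_le_erad_add`), the
  combinatorial fact behind Manacher's linear-time computation of the table; prefix palindromes are
  read off the table (`reverse_take_eq_iff_erad_eq`, `palindrome_take_iff_erad_eq`: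
  `x[0 … 2i-1]` is a palindrome iff `Rad[i] = i`).
* **Even palstars (Knuth, Morris and Pratt).**  `IsEvenPal` (non-empty even palindromes),
  `IsEvenPalstar` (their compositions), `first1` (length of the shortest even prefix palindrome)
  and the **Claim `parse1 = first1`** in the form `IsEvenPalstar.drop_first1`: removing the shortest
  even prefix palindrome of a non-empty even palstar leaves an even palstar.  Hence the greedy
  function `PALSTAR` (`evenPalstarTest`, with `evenPalstarTest_iff`) decides even palstars, which
  gives the `Decidable` instance; examples are evaluated by `decide`.

The proof of the Claim is the book's: two even prefix palindromes of lengths `f < p < 2f` yield one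
of length `2f - p < f` (`reverse_take_eq_of_two_prefixes`, via borders of symmetric words), and for
`p ≥ 2f` the longer one splits as `u z u` with `z` symmetric (`eq_append_of_two_prefixes`).

Not formalised here: the linear running time of Manacher's algorithm and the algorithm itself
(only its combinatorial lemma), odd radii (symmetric), general palstars and the theorem of Galil and
Seiferas (`parse1(x) ∈ {first1(x), 2·first1(x) - 1, 2·first1(x) + 1}`, the book's Lemma 8.14) with
the linear-time recognition of `PAL*`, and compositions of exactly `k` palindromes.

## References

* [CrochemoreRytter1994] M. Crochemore, W. Rytter, *Text Algorithms*, Oxford University Press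
  (1994), §8.3, Lemma 8.11 and the Claim on even palstars (pp. 111–117 of the book).
* [KnuthMorrisPratt1977] D. E. Knuth, J. H. Morris, V. R. Pratt, *Fast pattern matching in
  strings*, SIAM J. Comput. 6 (1977) 323–350 — §6 (palstars; the source of the Claim).
* G. Manacher, *A new linear-time "on-line" algorithm for finding the smallest initial palindrome
  of a string*, J. ACM 22 (1975) 346–351 (the table of radii and Lemma 8.11's use).
-/

namespace Literature.Combinatorics.Words

open List Nat
open Literature.Computability.StringMatching (lcp lcp_prefix_left lcp_prefix_right
  length_lcp_le_left length_lcp_le_right getElem?_eq_of_lt_length_lcp getElem?_ne_at_length_lcp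
  length_lcp_eq_of take_prefix_iff_le_length_lcp)

variable {α : Type*}

/-! ### A structural least-element search (so that `decide` evaluates the tables below) -/

section Search

/-- Search for the least `s' ≥ s` satisfying `p` among `s, s + 1, …` with `fuel` further steps;
returns `s + fuel` on exhaustion when `p (s + fuel)` fails too. [folklore] -/
private def leastSearch (p : ℕ → Prop) [DecidablePred p] : ℕ → ℕ → ℕ
  | 0, s => s
  | fuel + 1, s => if p s then s else leastSearch p fuel (s + 1)

/-- What the search returns: a value `≥ s`, nothing satisfying `p` strictly before it, and either
`p` holds there or it is the exhaustion value `s + fuel`. [folklore] -/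
private theorem leastSearch_spec (p : ℕ → Prop) [DecidablePred p] :
    ∀ fuel s, s ≤ leastSearch p fuel s ∧
      (∀ s', s ≤ s' → s' < leastSearch p fuel s → ¬ p s') ∧
      (p (leastSearch p fuel s) ∨ leastSearch p fuel s = s + fuel)
  | 0, s => ⟨le_rfl, fun s' h1 h2 => absurd h2 (by simp [leastSearch] at *; omega),
      by by_cases h : p s <;> simp [leastSearch, h]⟩
  | fuel + 1, s => by
    by_cases h : p s
    · simp only [leastSearch, if_pos h]
      exact ⟨le_rfl, fun s' h1 h2 => absurd h2 (by omega), Or.inl h⟩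
    · simp only [leastSearch, if_neg h]
      obtain ⟨h1, h2, h3⟩ := leastSearch_spec p fuel (s + 1)
      refine ⟨by omega, fun s' hs' hlt => ?_, ?_⟩
      · rcases Nat.eq_or_lt_of_le hs' with rfl | hlt'
        · exact h
        · exact h2 s' hlt' hlt
      · rcases h3 with h3 | h3
        · exact Or.inl h3
        · exact Or.inr (by omega)

/-- `leastPos p n`: the least `s` with `1 ≤ s ≤ n` satisfying `p`, and `0` if there is none (the
convention of the functions `first`, `first1` of Crochemore–Rytter §8.3). [folklore] -/
private def leastPos (p : ℕ → Prop) [DecidablePred p] (n : ℕ) : ℕ :=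
  if leastSearch p n 1 ≤ n then leastSearch p n 1 else 0

/-- If some `s ∈ [1, n]` satisfies `p`, `leastPos p n` is the least one. [folklore] -/
private theorem leastPos_spec {p : ℕ → Prop} [DecidablePred p] {n s : ℕ} (hs1 : 1 ≤ s)
    (hsn : s ≤ n) (hp : p s) :
    1 ≤ leastPos p n ∧ leastPos p n ≤ s ∧ p (leastPos p n) ∧
      ∀ s', 1 ≤ s' → s' < leastPos p n → ¬ p s' := by
  obtain ⟨h1, h2, h3⟩ := leastSearch_spec p n 1
  have hle : leastSearch p n 1 ≤ s := by
    by_contra h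
    exact h2 s hs1 (not_le.mp h) hp
  have hn : leastSearch p n 1 ≤ n := hle.trans hsn
  simp only [leastPos, if_pos hn]
  refine ⟨h1, hle, ?_, h2⟩
  rcases h3 with h3 | h3
  · exact h3
  · omega

/-- If no `s ∈ [1, n]` satisfies `p`, `leastPos p n = 0`. [folklore] -/
private theorem leastPos_eq_zero {p : ℕ → Prop} [DecidablePred p] {n : ℕ}
    (h : ∀ s, 1 ≤ s → s ≤ n → ¬ p s) : leastPos p n = 0 := by
  unfold leastPos
  split_ifs with hn
  · obtain ⟨h1, -, h3⟩ := leastSearch_spec p n 1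
    rcases h3 with h3 | h3
    · exact absurd h3 (h _ h1 hn)
    · omega
  · rfl

/-- `leastPos p n = 0` or it is a witness in `[1, n]`. [folklore] -/
private theorem leastPos_eq_zero_or {p : ℕ → Prop} [DecidablePred p] (n : ℕ) :
    leastPos p n = 0 ∨ (1 ≤ leastPos p n ∧ leastPos p n ≤ n ∧ p (leastPos p n) ∧
      ∀ s', 1 ≤ s' → s' < leastPos p n → ¬ p s') := by
  by_cases h : ∃ s, 1 ≤ s ∧ s ≤ n ∧ p s
  · obtain ⟨s, hs1, hsn, hp⟩ := h
    obtain ⟨a, b, c, d⟩ := leastPos_spec hs1 hsn hp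
    exact Or.inr ⟨a, b.trans hsn, c, d⟩
  · push Not at h
    exact Or.inl (leastPos_eq_zero h)

end Search

/-! ### Symmetric words -/

section Symmetric

/-- In a symmetric word the reverse of the prefix of length `m` is the suffix of length `m`. [folklore] -/
private theorem reverse_take_of_reverse_eq {w : List α} (hw : w.reverse = w) (m : ℕ) :
    (w.take m).reverse = w.drop (w.length - m) := by
  conv_lhs => rw [← hw]
  rw [List.take_reverse, List.reverse_reverse]

/-- In a symmetric word the reverse of the suffix after `m` letters is the prefix of length
`|w| - m`. [folklore] -/
private theorem reverse_drop_of_reverse_eq {w : List α} (hw : w.reverse = w) (m : ℕ) :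
    (w.drop m).reverse = w.take (w.length - m) := by
  conv_lhs => rw [← hw]
  rw [List.drop_reverse, List.reverse_reverse]

/-- A symmetric prefix of a symmetric word is also its suffix of the same length (a border). [folklore] -/
private theorem drop_eq_take_of_reverse_eq {w : List α} (hw : w.reverse = w) {m : ℕ}
    (hu : (w.take m).reverse = w.take m) : w.drop (w.length - m) = w.take m := by
  rw [← reverse_take_of_reverse_eq hw, hu]

/-- Two symmetric prefixes of lengths `f < p ≤ 2 f`: the prefix of length `2 f - p` is symmetric
(it is a border of the shorter one, and a border of a symmetric word is symmetric). [folklore] -/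
private theorem reverse_take_eq_of_two_prefixes {x : List α} {f p : ℕ} (hfp : f ≤ p)
    (hp2 : p ≤ 2 * f) (hpx : p ≤ x.length) (hf : (x.take f).reverse = x.take f)
    (hp : (x.take p).reverse = x.take p) :
    (x.take (2 * f - p)).reverse = x.take (2 * f - p) := by
  set w := x.take p with hw
  set u := x.take f with hu_def
  have hwl : w.length = p := by simp [hw, Nat.min_eq_left hpx]
  have hul : u.length = f := by simp [hu_def]; omega
  have huw : w.take f = u := by rw [hw, List.take_take, Nat.min_eq_left hfp]
  -- `u` is a suffix of `w`: `w = t ++ u` with `|t| = p - f =: d`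
  have hsuf : w.drop (p - f) = u := by
    have := drop_eq_take_of_reverse_eq hp (m := f) (by rw [huw]; exact hf)
    rwa [hwl, huw] at this
  set d := p - f with hd
  have hdf : d ≤ f := by omega
  -- `u = t ++ u.take (f - d)` where `t = w.take d`
  have hsplit : u = w.take d ++ u.take (f - d) := by
    have e1 : w = w.take d ++ u := by rw [← hsuf, List.take_append_drop]
    have e2 : u = (w.take d ++ u).take f := by rw [← e1, huw]
    have hlt : (w.take d).length = d := by simp [hwl]; omega
    rw [List.take_append, hlt, List.take_of_length_le (by omega)] at e2
    exact e2
  -- hence `b := u.take (f - d)` is both a prefix and a suffix of `u`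
  have hb : u.drop d = u.take (f - d) := by
    have e : u.take d ++ u.drop d = w.take d ++ u.take (f - d) := by
      rw [List.take_append_drop]; exact hsplit
    have hl : (u.take d).length = (w.take d).length := by simp [hul, hwl]; omega
    exact (List.append_inj e hl).2
  -- and a border of the symmetric word `u` is symmetric
  have hbrev : (u.take (f - d)).reverse = u.take (f - d) := by
    have := reverse_take_of_reverse_eq hf (f - d)
    rw [hul, show f - (f - d) = d by omega, hb] at this
    exact this
  have e : x.take (2 * f - p) = u.take (f - d) := by
    rw [hu_def, List.take_take, show 2 * f - p = f - d by omega, Nat.min_eq_left (by omega)]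
  rw [e]; exact hbrev

/-- A symmetric prefix `u` of length `f` of a symmetric word `w` of length `p ≥ 2 f`:
`w = u ++ z ++ u` with `z` symmetric. [folklore] -/
private theorem eq_append_of_two_prefixes {x : List α} {f p : ℕ} (h2f : 2 * f ≤ p)
    (hpx : p ≤ x.length) (hf : (x.take f).reverse = x.take f)
    (hp : (x.take p).reverse = x.take p) :
    x.take p = x.take f ++ (x.drop f).take (p - 2 * f) ++ x.take f ∧
      ((x.drop f).take (p - 2 * f)).reverse = (x.drop f).take (p - 2 * f) := by
  set w := x.take p with hw
  set u := x.take f with hu_def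
  set z := (x.drop f).take (p - 2 * f) with hz
  have hwl : w.length = p := by simp [hw, Nat.min_eq_left hpx]
  have hul : u.length = f := by simp [hu_def]; omega
  have hzl : z.length = p - 2 * f := by simp [hz]; omega
  -- `w = u ++ z ++ u₂` with `u₂ = w.drop (p - f)`
  have hdec : w = u ++ z ++ w.drop (p - f) := by
    have e1 : w = w.take f ++ w.drop f := (List.take_append_drop f w).symm
    have e2 : w.drop f = (w.drop f).take (p - 2 * f) ++ (w.drop f).drop (p - 2 * f) :=
      (List.take_append_drop _ _).symm
    have huw : w.take f = u := by rw [hw, List.take_take, Nat.min_eq_left (by omega)]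
    have hzw : (w.drop f).take (p - 2 * f) = z := by
      apply List.ext_getElem?
      intro i
      simp only [hz, hw, List.getElem?_take, List.getElem?_drop]
      split_ifs <;> first | rfl | omega
    rw [List.drop_drop, show f + (p - 2 * f) = p - f by omega] at e2
    rw [huw] at e1; rw [hzw] at e2
    conv_lhs => rw [e1, e2]
    rw [List.append_assoc]
  have hu2l : (w.drop (p - f)).length = f := by simp [hwl]; omega
  -- reverse and compare blocks of equal lengths
  have hrev : (w.drop (p - f)).reverse ++ (z.reverse ++ u.reverse) = u ++ (z ++ w.drop (p - f)) := by
    have h1 := congrArg List.reverse hdec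
    simp only [List.reverse_append, List.append_assoc] at h1
    rw [hp] at h1
    rw [← h1]
    exact hdec.trans (List.append_assoc _ _ _)
  obtain ⟨e1, e2⟩ := List.append_inj hrev (by rw [List.length_reverse, hu2l, hul])
  obtain ⟨e3, e4⟩ := List.append_inj e2 (by rw [List.length_reverse])
  refine ⟨?_, e3⟩
  have hu2 : w.drop (p - f) = u := by rw [← e4, hf]
  conv_lhs => rw [hdec, hu2]

end Symmetric

/-! ### Radii of even palindromes (Manacher; Crochemore–Rytter Lemma 8.11) -/

section Radii

variable [DecidableEq α]

/-- **`Rad[i]`**: the radius of the longest even palindrome of `x` centred between positions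
`c - 1` and `c` ("the maximum value of `j` satisfying `w(i, j): text[i-j+1 … i] = text[i+1 … i+j]`
… is called the radius of the palindrome centered at `i`, and denoted by `Rad[i]`"), here as the
length of the longest common prefix of `(x[0 … c-1])~` and `x[c …]`.
[cite: CrochemoreRytter1994, §8.3 (table Rad)] -/
def erad (x : List α) (c : ℕ) : ℕ := (lcp (x.take c).reverse (x.drop c)).length

/-- `Rad[i] ≤ i`: a radius does not pass the left end. [cite: CrochemoreRytter1994, §8.3 (table Rad)] -/
theorem erad_le_left (x : List α) (c : ℕ) : erad x c ≤ c := by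
  have h := length_lcp_le_left (x.take c).reverse (x.drop c)
  simp only [List.length_reverse, List.length_take] at h
  exact h.trans (Nat.min_le_left _ _)

/-- `Rad[i] ≤ n - i`: a radius does not pass the right end. [cite: CrochemoreRytter1994, §8.3 (table Rad)] -/
theorem erad_le_right (x : List α) (c : ℕ) : erad x c ≤ x.length - c := by
  unfold erad
  have h := length_lcp_le_right (x.take c).reverse (x.drop c)
  simpa only [List.length_drop] using h

omit [DecidableEq α] in
/-- Letters of the reversed prefix. [folklore] -/
private theorem getElem?_reverse_take {x : List α} {c j : ℕ} (hc : c ≤ x.length) (hj : j < c) :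
    ((x.take c).reverse)[j]? = x[c - 1 - j]? := by
  rw [List.getElem?_reverse (by simp; omega), List.length_take, Nat.min_eq_left hc, List.getElem?_take,
    if_pos (by omega)]

/-- A common prefix of length `m` (letterwise) bounds `|lcp(u, v)|` from below. [folklore] -/
private theorem le_length_lcp_of_forall_getElem?_eq {u v : List α} {m : ℕ} (hmv : m ≤ v.length)
    (h : ∀ j < m, u[j]? = v[j]?) : m ≤ (lcp u v).length := by
  rw [← take_prefix_iff_le_length_lcp hmv]
  have e : v.take m = u.take m := by
    apply List.ext_getElem?
    intro i
    simp only [List.getElem?_take]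
    split_ifs with hi
    · exact (h i hi).symm
    · rfl
  rw [e]
  exact List.take_prefix m u

/-- **The invariant `w(i, j)`, letterwise**: the letters at distance `j < Rad[i]` on both sides of
the centre agree. [cite: CrochemoreRytter1994, §8.3 (table Rad, invariant w(i, j))] -/
theorem getElem?_eq_of_lt_erad {x : List α} {c j : ℕ} (hj : j < erad x c) :
    x[c - 1 - j]? = x[c + j]? := by
  have h1 := erad_le_left x c
  have h2 := erad_le_right x c
  have hc : c ≤ x.length := by omega
  have h := getElem?_eq_of_lt_length_lcp hj
  rwa [getElem?_reverse_take hc (by omega), List.getElem?_drop] at h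

/-- **Maximality of `Rad[i]`**: if both sides continue, the next pair of letters disagrees.
[cite: CrochemoreRytter1994, §8.3 (table Rad)] -/
theorem getElem?_ne_at_erad {x : List α} {c : ℕ} (h1 : erad x c < c)
    (h2 : c + erad x c < x.length) : x[c - 1 - erad x c]? ≠ x[c + erad x c]? := by
  have hc : c ≤ x.length := by omega
  unfold erad at h1 h2 ⊢
  have h := getElem?_ne_at_length_lcp (u := (x.take c).reverse) (v := x.drop c)
    (by simp only [List.length_reverse, List.length_take]; omega) (by simp only [List.length_drop]; omega)
  rwa [getElem?_reverse_take hc h1, List.getElem?_drop] at h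

/-- A palindrome of radius `n` centred at `i` gives `n ≤ Rad[i]`. [cite: CrochemoreRytter1994, §8.3 (table Rad)] -/
theorem le_erad_of {x : List α} {c n : ℕ} (hn : n ≤ c) (hcn : c + n ≤ x.length)
    (h : ∀ j < n, x[c - 1 - j]? = x[c + j]?) : n ≤ erad x c := by
  have hc : c ≤ x.length := by omega
  unfold erad
  refine le_length_lcp_of_forall_getElem?_eq (by simp only [List.length_drop]; omega) fun j hj => ?_
  rw [getElem?_reverse_take hc (by omega), List.getElem?_drop]
  exact h j hj

/-- **`Rad[i]` determined**: radius `n` matches and cannot be extended (an end of the text, or a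
mismatch) iff `Rad[i] = n`. [cite: CrochemoreRytter1994, §8.3 (table Rad)] -/
theorem erad_eq_of {x : List α} {c n : ℕ} (hn : n ≤ c) (hcn : c + n ≤ x.length)
    (h : ∀ j < n, x[c - 1 - j]? = x[c + j]?)
    (hmax : n = c ∨ c + n = x.length ∨ x[c - 1 - n]? ≠ x[c + n]?) : erad x c = n := by
  have hc : c ≤ x.length := by omega
  unfold erad
  refine length_lcp_eq_of (by simp only [List.length_reverse, List.length_take]; omega)
    (fun j hj => ?_) ?_
  · rw [getElem?_reverse_take hc (by omega), List.getElem?_drop]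
    exact h j hj
  · by_cases hlt : n < c
    · rcases hmax with e | e | hne
      · omega
      · right; left; simp only [List.length_drop]; omega
      · right; right
        rwa [getElem?_reverse_take hc hlt, List.getElem?_drop]
    · left; simp only [List.length_reverse, List.length_take]; omega

/-- Symmetry about the centre `i` transports a window at `i - k` to the mirror window at `i + k`
(the step "position `i - k` is symmetrical to `i + k` with respect to `i`"). [folklore] -/
private theorem getElem?_transfer {x : List α} {c k j : ℕ} (hk : k ≤ erad x c)
    (hj : j < erad x c - k) : x[c + k - 1 - j]? = x[c - k + j]? := by
  have hRc := erad_le_left x c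
  rcases Nat.lt_or_ge j k with hjk | hjk
  · have e := getElem?_eq_of_lt_erad (x := x) (c := c) (j := k - 1 - j) (by omega)
    rw [show c - 1 - (k - 1 - j) = c - k + j by omega,
      show c + (k - 1 - j) = c + k - 1 - j by omega] at e
    exact e.symm
  · have e := getElem?_eq_of_lt_erad (x := x) (c := c) (j := j - k) (by omega)
    rw [show c - 1 - (j - k) = c + k - 1 - j by omega, show c + (j - k) = c - k + j by omega] at e
    exact e

/-- **Lemma 8.11, the inequality behind it**: for `k ≤ Rad[i]`,
`Rad[i + k] ≥ min(Rad[i - k], Rad[i] - k)` (the palindrome centred at `i - k`, clipped to the big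
palindrome, is mirrored at `i + k`). [cite: CrochemoreRytter1994, §8.3 Lemma 8.11 (proof, case (a))] -/
theorem min_le_erad_add {x : List α} {c k : ℕ} (hk : k ≤ erad x c) :
    min (erad x (c - k)) (erad x c - k) ≤ erad x (c + k) := by
  have hRc := erad_le_left x c
  have hRx := erad_le_right x c
  have hrc := erad_le_left x (c - k)
  by_cases h0 : min (erad x (c - k)) (erad x c - k) = 0
  · rw [h0]; exact Nat.zero_le _
  refine le_erad_of (by omega) (by omega) fun j hj => ?_
  have hj1 : j < erad x (c - k) := lt_of_lt_of_le hj (Nat.min_le_left _ _)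
  have hj2 : j < erad x c - k := lt_of_lt_of_le hj (Nat.min_le_right _ _)
  have e1 := getElem?_transfer hk hj2
  have e2 := getElem?_eq_of_lt_erad hj1
  have e3 := getElem?_eq_of_lt_erad (x := x) (c := c) (j := k + j) (by omega)
  rw [show c - 1 - (k + j) = c - k - 1 - j by omega, show c + (k + j) = c + k + j by omega] at e3
  rw [e1, ← e2, e3]

/-- **Lemma 8.11 (Manacher).** If `1 ≤ k ≤ Rad[i]` and `Rad[i - k] ≠ Rad[i] - k`, then
`Rad[i + k] = min(Rad[i - k], Rad[i] - k)` — new entries of the table without comparing symbols.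
[cite: CrochemoreRytter1994, §8.3 Lemma 8.11] -/
theorem erad_add_eq_min {x : List α} {c k : ℕ} (hk : k ≤ erad x c)
    (hne : erad x (c - k) ≠ erad x c - k) :
    erad x (c + k) = min (erad x (c - k)) (erad x c - k) := by
  have hRc := erad_le_left x c
  have hRx := erad_le_right x c
  have hrc := erad_le_left x (c - k)
  have hrx := erad_le_right x (c - k)
  have hk0 : 0 < k := by
    rcases Nat.eq_zero_or_pos k with h0 | h0
    · exfalso; subst h0; simp only [Nat.sub_zero] at hne; exact hne rfl
    · exact h0
  rcases Nat.lt_or_gt_of_ne hne with hlt | hgt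
  · -- case (a): `Rad[i-k] < Rad[i]-k`
    rw [Nat.min_eq_left hlt.le]
    refine erad_eq_of (by omega) (by omega) (fun j hj => ?_) ?_
    · have e1 := getElem?_transfer hk (lt_trans hj hlt)
      have e2 := getElem?_eq_of_lt_erad hj
      have e3 := getElem?_eq_of_lt_erad (x := x) (c := c) (j := k + j) (by omega)
      rw [show c - 1 - (k + j) = c - k - 1 - j by omega, show c + (k + j) = c + k + j by omega] at e3
      rw [e1, ← e2, e3]
    · right; right
      have m := getElem?_ne_at_erad (x := x) (c := c - k) (by omega) (by omega)
      have e1 := getElem?_transfer hk hlt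
      have e3 := getElem?_eq_of_lt_erad (x := x) (c := c) (j := k + erad x (c - k)) (by omega)
      rw [show c - 1 - (k + erad x (c - k)) = c - k - 1 - erad x (c - k) by omega,
        show c + (k + erad x (c - k)) = c + k + erad x (c - k) by omega] at e3
      rw [e1, ← e3]
      exact m.symm
  · -- case (b): `Rad[i-k] > Rad[i]-k`
    rw [Nat.min_eq_right hgt.le]
    refine erad_eq_of (by omega) (by omega) (fun j hj => ?_) ?_
    · have e1 := getElem?_transfer hk hj
      have e2 := getElem?_eq_of_lt_erad (lt_trans hj hgt)
      have e3 := getElem?_eq_of_lt_erad (x := x) (c := c) (j := k + j) (by omega)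
      rw [show c - 1 - (k + j) = c - k - 1 - j by omega, show c + (k + j) = c + k + j by omega] at e3
      rw [e1, ← e2, e3]
    · by_cases hb : c + erad x c = x.length
      · right; left; omega
      · right; right
        have m := getElem?_ne_at_erad (x := x) (c := c) (by omega) (by omega)
        have e3 : x[c + k + (erad x c - k)]? = x[c + erad x c]? := by
          rw [show c + k + (erad x c - k) = c + erad x c by omega]
        have e1 : x[c + k - 1 - (erad x c - k)]? = x[c + erad x c - 2 * k]? := by
          rcases Nat.lt_or_ge (erad x c - k) k with h | h
          · have e := getElem?_eq_of_lt_erad (x := x) (c := c) (j := 2 * k - 1 - erad x c) (by omega)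
            rw [show c - 1 - (2 * k - 1 - erad x c) = c + erad x c - 2 * k by omega,
              show c + (2 * k - 1 - erad x c) = c + k - 1 - (erad x c - k) by omega] at e
            exact e.symm
          · have e := getElem?_eq_of_lt_erad (x := x) (c := c) (j := erad x c - 2 * k) (by omega)
            rw [show c - 1 - (erad x c - 2 * k) = c + k - 1 - (erad x c - k) by omega,
              show c + (erad x c - 2 * k) = c + erad x c - 2 * k by omega] at e
            exact e
        have e2 := getElem?_eq_of_lt_erad hgt
        rw [show c - k - 1 - (erad x c - k) = c - 1 - erad x c by omega,
          show c - k + (erad x c - k) = c + erad x c - 2 * k by omega] at e2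
        rw [e1, ← e2, e3]
        exact m

/-- **Prefix palindromes from the table**: `x[0 … 2i-1]` is an (even) palindrome iff `Rad[i] = i`
("a palindrome centered in `i` is actually a prefix palindrome iff `Rad[i] = i - 1`", the book's
shift by one coming from its sentinel symbol). [cite: CrochemoreRytter1994, §8.3 (table Rad)] -/
theorem reverse_take_eq_iff_erad_eq {x : List α} {c : ℕ} (hc : 2 * c ≤ x.length) :
    (x.take (2 * c)).reverse = x.take (2 * c) ↔ erad x c = c := by
  constructor
  · intro h
    refine le_antisymm (erad_le_left x c) (le_erad_of le_rfl (by omega) fun j hj => ?_)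
    have e : ((x.take (2 * c)).reverse)[c + j]? = (x.take (2 * c))[c + j]? := by rw [h]
    rw [List.getElem?_reverse (by simp; omega), List.length_take, Nat.min_eq_left hc,
      List.getElem?_take, List.getElem?_take, if_pos (by omega), if_pos (by omega),
      show 2 * c - 1 - (c + j) = c - 1 - j by omega] at e
    exact e
  · intro h
    apply List.ext_getElem?
    intro i
    by_cases hi : i < 2 * c
    · rw [List.getElem?_reverse (by simp; omega), List.length_take, Nat.min_eq_left hc,
        List.getElem?_take, List.getElem?_take, if_pos (by omega), if_pos hi]
      rcases Nat.lt_or_ge i c with hic | hic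
      · have e := getElem?_eq_of_lt_erad (x := x) (c := c) (j := c - 1 - i) (by omega)
        rw [show c - 1 - (c - 1 - i) = i by omega, show c + (c - 1 - i) = 2 * c - 1 - i by omega] at e
        exact e.symm
      · have e := getElem?_eq_of_lt_erad (x := x) (c := c) (j := i - c) (by omega)
        rw [show c - 1 - (i - c) = 2 * c - 1 - i by omega, show c + (i - c) = i by omega] at e
        exact e
    · rw [List.getElem?_eq_none_iff.mpr (by simp; omega), List.getElem?_eq_none_iff.mpr (by simp; omega)]

/-- The same with Mathlib's `List.Palindrome`: the prefix of length `2i` is a palindrome iff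
`Rad[i] = i`. [cite: CrochemoreRytter1994, §8.3 (table Rad, prefix palindromes)] -/
theorem palindrome_take_iff_erad_eq {x : List α} {c : ℕ} (hc : 2 * c ≤ x.length) :
    (x.take (2 * c)).Palindrome ↔ erad x c = c :=
  (List.Palindrome.iff_reverse_eq).trans (reverse_take_eq_iff_erad_eq hc)

/-- The table `Rad` of `abbaabba`. -/
example : (List.range 9).map (erad [0, 1, 1, 0, 0, 1, 1, 0]) = [0, 0, 2, 0, 4, 0, 2, 0, 0] := by decide

/-- Lemma 8.11 at work on `abbaabba` with `i = 4`, `Rad[4] = 4`: `Rad[4 + 1] = min(Rad[3], 3) = 0` and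
`Rad[4 + 3] = min(Rad[1], 1) = 0` are forced (`Rad[3] = 0 ≠ 3`, `Rad[1] = 0 ≠ 1`), while at `k = 2`
the lemma is silent (`Rad[2] = 2 = Rad[4] - 2`, the excluded case). -/
example : erad [0, 1, 1, 0, 0, 1, 1, 0] (4 + 1) = min (erad [0, 1, 1, 0, 0, 1, 1, 0] (4 - 1)) (4 - 1) ∧
    erad [0, 1, 1, 0, 0, 1, 1, 0] (4 + 3) = min (erad [0, 1, 1, 0, 0, 1, 1, 0] (4 - 3)) (4 - 3) := by
  decide

end Radii

/-! ### Even palstars: the greedy parsing is sound (Knuth, Morris and Pratt) -/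

section EvenPalstars

variable [DecidableEq α]

/-- An **even palindrome**: a non-empty symmetric word of even length.
[cite: CrochemoreRytter1994, §8.3 (even palindromes and palstars)] -/
def IsEvenPal (w : List α) : Prop := w ≠ [] ∧ w.reverse = w ∧ Even w.length

/-- Even palindromes are recognised letter by letter. [folklore] -/
instance (w : List α) : Decidable (IsEvenPal w) := by
  unfold IsEvenPal; infer_instance

/-- **Even palstars**: compositions of even palindromes (the language `P*` for `P` the even
palindromes; the empty composition is allowed). [cite: CrochemoreRytter1994, §8.3 (palstars)] -/
def IsEvenPalstar (x : List α) : Prop :=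
  ∃ L : List (List α), (∀ w ∈ L, IsEvenPal w) ∧ L.flatten = x

omit [DecidableEq α] in
/-- The empty word is an even palstar (empty composition). [cite: CrochemoreRytter1994, §8.3 (palstars)] -/
theorem isEvenPalstar_nil : IsEvenPalstar ([] : List α) := ⟨[], by simp, rfl⟩

omit [DecidableEq α] in
/-- An even palindrome is an even palstar. [cite: CrochemoreRytter1994, §8.3 (palstars)] -/
theorem IsEvenPal.isEvenPalstar {w : List α} (h : IsEvenPal w) : IsEvenPalstar w :=
  ⟨[w], by simpa using h, by simp⟩

omit [DecidableEq α] in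
/-- Even palstars are closed under concatenation. [cite: CrochemoreRytter1994, §8.3 (palstars)] -/
theorem IsEvenPalstar.append {x y : List α} (hx : IsEvenPalstar x) (hy : IsEvenPalstar y) :
    IsEvenPalstar (x ++ y) := by
  obtain ⟨L, hL, rfl⟩ := hx
  obtain ⟨M, hM, rfl⟩ := hy
  refine ⟨L ++ M, fun w hw => ?_, by simp⟩
  rcases List.mem_append.mp hw with h | h
  · exact hL w h
  · exact hM w h

omit [DecidableEq α] in
/-- A non-empty even palstar starts with an even palindrome (the first component of a parsing,
of length `parse1(x)` in the book's notation) followed by an even palstar.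
[cite: CrochemoreRytter1994, §8.3 (function parse1)] -/
theorem IsEvenPalstar.exists_take {x : List α} (hx : IsEvenPalstar x) (hne : x ≠ []) :
    ∃ p, 1 ≤ p ∧ p ≤ x.length ∧ IsEvenPal (x.take p) ∧ IsEvenPalstar (x.drop p) := by
  obtain ⟨L, hL, rfl⟩ := hx
  cases L with
  | nil => simp at hne
  | cons w L =>
    have hw : IsEvenPal w := hL w (by simp)
    have hw0 : 1 ≤ w.length := List.length_pos_of_ne_nil hw.1
    refine ⟨w.length, hw0, by simp, ?_, ?_⟩
    · simpa using hw
    · rw [List.flatten_cons, List.drop_left]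
      exact ⟨L, fun v hv => hL v (by simp [hv]), rfl⟩

/-- **`first1(x)`**: the length of the shortest even palindrome that is a prefix of `x`
(`0` if there is none). [cite: CrochemoreRytter1994, §8.3 (function first1)] -/
def first1 (x : List α) : ℕ := leastPos (fun n => IsEvenPal (x.take n)) x.length

/-- What `first1` returns: `0`, or the least length of an even prefix palindrome.
[cite: CrochemoreRytter1994, §8.3 (function first1)] -/
theorem first1_eq_zero_or (x : List α) :
    first1 x = 0 ∨ (1 ≤ first1 x ∧ first1 x ≤ x.length ∧ IsEvenPal (x.take (first1 x)) ∧
      ∀ n, 1 ≤ n → n < first1 x → ¬ IsEvenPal (x.take n)) :=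
  leastPos_eq_zero_or (p := fun n => IsEvenPal (x.take n)) x.length

omit [DecidableEq α] in
/-- Lengths of prefixes. [folklore] -/
private theorem length_take_of_le {x : List α} {n : ℕ} (h : n ≤ x.length) : (x.take n).length = n := by
  simp [h]

/-- **Claim (Knuth, Morris and Pratt): `parse1(x) = first1(x)` for even palstars** — in the form the
algorithm uses: a non-empty even palstar has an even prefix palindrome, and removing the SHORTEST
one leaves an even palstar.  (If a parsing started with a longer even palindrome of length `p`,
then `p < 2·first1` would exhibit a shorter even prefix palindrome of length `2·first1 - p`, and
`p ≥ 2·first1` splits that component as `u z u` with `z` an even palindrome or empty.)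
[cite: CrochemoreRytter1994, §8.3 (Claim: parse1 = first1 for even palstars)] -/
theorem IsEvenPalstar.drop_first1 {x : List α} (hx : IsEvenPalstar x) (hne : x ≠ []) :
    1 ≤ first1 x ∧ IsEvenPalstar (x.drop (first1 x)) := by
  obtain ⟨p, hp1, hpx, hpal, hrest⟩ := hx.exists_take hne
  have key : 1 ≤ first1 x ∧ first1 x ≤ p ∧ IsEvenPal (x.take (first1 x)) ∧
      ∀ n, 1 ≤ n → n < first1 x → ¬ IsEvenPal (x.take n) :=
    leastPos_spec (p := fun n => IsEvenPal (x.take n)) hp1 hpx hpal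
  obtain ⟨hf1, hfp, hfpal, hmin⟩ := key
  set f := first1 x with hf_def
  refine ⟨hf1, ?_⟩
  have hfx : f ≤ x.length := hfp.trans hpx
  have hlenf : (x.take f).length = f := length_take_of_le hfx
  have hlenp : (x.take p).length = p := length_take_of_le hpx
  obtain ⟨a, ha⟩ := hfpal.2.2
  obtain ⟨b, hb⟩ := hpal.2.2
  rw [hlenf] at ha
  rw [hlenp] at hb
  rcases Nat.lt_or_ge p (2 * f) with hlt | hge
  · by_cases hfeq : f = p
    · rw [hfeq]; exact hrest
    · exfalso
      have hsym := reverse_take_eq_of_two_prefixes hfp hlt.le hpx hfpal.2.1 hpal.2.1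
      refine hmin (2 * f - p) (by omega) (by omega) ⟨?_, hsym, ?_⟩
      · apply List.ne_nil_of_length_pos
        rw [length_take_of_le (by omega)]; omega
      · rw [length_take_of_le (by omega)]; exact ⟨a + a - b, by omega⟩
  · obtain ⟨hdec, hz⟩ := eq_append_of_two_prefixes hge hpx hfpal.2.1 hpal.2.1
    have e1 : x = x.take f ++ ((x.drop f).take (p - 2 * f) ++ (x.take f ++ x.drop p)) := by
      calc x = x.take p ++ x.drop p := (List.take_append_drop p x).symm
        _ = x.take f ++ (x.drop f).take (p - 2 * f) ++ x.take f ++ x.drop p := by rw [hdec]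
        _ = x.take f ++ ((x.drop f).take (p - 2 * f) ++ (x.take f ++ x.drop p)) := by
          simp only [List.append_assoc]
    have hsplit : x.drop f = (x.drop f).take (p - 2 * f) ++ (x.take f ++ x.drop p) := by
      have e2 := congrArg (List.drop f) e1
      have hnil : (x.take f).drop f = [] := by simp
      rwa [List.drop_append_of_le_length (le_of_eq hlenf.symm), hnil, List.nil_append] at e2
    rw [hsplit]
    refine IsEvenPalstar.append ?_ (hfpal.isEvenPalstar.append hrest)
    by_cases hz0 : p - 2 * f = 0
    · rw [hz0, List.take_zero]; exact isEvenPalstar_nil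
    · refine IsEvenPal.isEvenPalstar ⟨?_, hz, ?_⟩
      · apply List.ne_nil_of_length_pos
        rw [List.length_take, List.length_drop]; omega
      · rw [List.length_take, List.length_drop, Nat.min_eq_left (by omega)]
        exact ⟨b - (a + a), by omega⟩

/-- A positive `first1` names an even prefix palindrome. [cite: CrochemoreRytter1994, §8.3 (function first1)] -/
theorem isEvenPal_take_first1 {x : List α} (h : 1 ≤ first1 x) :
    IsEvenPal (x.take (first1 x)) ∧ first1 x ≤ x.length := by
  rcases first1_eq_zero_or x with h0 | ⟨_, h2, h3, _⟩
  · omega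
  · exact ⟨h3, h2⟩

/-- **Algorithm PALSTAR** for even palstars (greedy: repeatedly remove the shortest even prefix
palindrome), with a step counter. [cite: CrochemoreRytter1994, §8.3 (function PALSTAR)] -/
def evenPalstarAux : ℕ → List α → Bool
  | 0, x => x.isEmpty
  | fuel + 1, x =>
    if x = [] then true else if first1 x = 0 then false else evenPalstarAux fuel (x.drop (first1 x))

/-- `PALSTAR(x)` for even palstars. [cite: CrochemoreRytter1994, §8.3 (function PALSTAR)] -/
def evenPalstarTest (x : List α) : Bool := evenPalstarAux x.length x

/-- Correctness of the greedy test with enough fuel. [cite: CrochemoreRytter1994, §8.3 (function PALSTAR, correctness via the Claim)] -/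
theorem evenPalstarAux_iff :
    ∀ (fuel : ℕ) (x : List α), x.length ≤ fuel → (evenPalstarAux fuel x = true ↔ IsEvenPalstar x)
  | 0, x, hx => by
    have h0 : x = [] := List.eq_nil_of_length_eq_zero (by omega)
    subst h0
    simp [evenPalstarAux, isEvenPalstar_nil]
  | fuel + 1, x, hx => by
    by_cases h0 : x = []
    · subst h0
      simp [evenPalstarAux, isEvenPalstar_nil]
    · simp only [evenPalstarAux, if_neg h0]
      by_cases hf : first1 x = 0
      · rw [if_pos hf]
        constructor
        · intro h; exact absurd h Bool.false_ne_true
        · intro hp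
          have := (hp.drop_first1 h0).1
          omega
      · rw [if_neg hf]
        have hlt : (x.drop (first1 x)).length ≤ fuel := by
          have := List.length_pos_of_ne_nil h0
          simp only [List.length_drop]; omega
        rw [evenPalstarAux_iff fuel (x.drop (first1 x)) hlt]
        constructor
        · intro h
          have hpal := (isEvenPal_take_first1 (x := x) (by omega)).1
          have h' := hpal.isEvenPalstar.append h
          rwa [List.take_append_drop] at h'
        · intro hp
          exact (hp.drop_first1 h0).2

/-- **Theorem (Knuth, Morris and Pratt 1977): even palstars are recognised by the greedy algorithm**
— `PALSTAR(x)` answers whether `x` is an even palstar. [cite: CrochemoreRytter1994, §8.3 (function PALSTAR is correct for even palstars)] -/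
theorem evenPalstarTest_iff (x : List α) : evenPalstarTest x = true ↔ IsEvenPalstar x :=
  evenPalstarAux_iff x.length x le_rfl

/-- Hence being an even palstar is decidable (by running `PALSTAR`). [folklore] -/
instance (x : List α) : Decidable (IsEvenPalstar x) := decidable_of_iff _ (evenPalstarTest_iff x)

/-- `abba·aa` is an even palstar; `abbaab` is not (its only even prefix palindrome is `abba`,
and `ab` is not one). -/
example : IsEvenPalstar [0, 1, 1, 0, 0, 0] ∧ ¬ IsEvenPalstar [0, 1, 1, 0, 0, 1] := by decide

/-- The greedy choice is the SHORTEST even prefix palindrome: on `aaaabb = aa·aa·bb` one has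
`first1 = 2` although `aaaa` is also an even prefix palindrome. -/
example : first1 [0, 0, 0, 0, 1, 1] = 2 ∧ IsEvenPalstar [0, 0, 0, 0, 1, 1] := by decide

end EvenPalstars

end Literature.Combinatorics.Words
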